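import Summits.ValiantsHypothesis.ValiantsHypothesis.Theses.BinomialElusive

/-!
# `PeelingLemma` (crux stmt-ValiantsHypothesis-7391): false modulo the existence of ALL-X DESIGNS

Negative-lane lemma (val-width-7391-p1, 2026-08-27).  An **all-X design** at size `m` is purely
combinatorial integer data: `m - 1` registers, each either a "monomial" register with one exponent
`α j` or a "binomial" register with two exponents `α j, β j`, and for every output `i < m` two binomial
registers `v i, w i` and four monomial registers `a i, b i, c i, d i` with the two PLANTED COINCIDENCES
`α(v i) + α(w i) = α(a i) + α(b i)` and `β(v i) + β(w i) = α(c i) + α(d i)`; its output exponents are the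
cross sums `e₁ i = α(v i) + β(w i)`, `e₂ i = β(v i) + α(w i)`.  The quadratic map
`Γ_i = z_{v i} z_{w i} - z_{a i} z_{b i} - z_{c i} z_{d i}` evaluated at the Laurent binomials / monomials
`p_j = t^{α j} (+ t^{β j})` is then EXACTLY `t^{e₁ i} + t^{e₂ i}` (the pure terms cancel against the two
monomial products; `aeval_allX`).  Hence (`peelingLemma_false_of_allXDesigns`):

  if for every `m₀` there is an all-X design at some `m ≥ m₀` whose `2m` output exponents admit no
  nonzero integer relation of length `≤ ⌊log₂ m⌋²`, then `PeelingLemma` is false.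

The hypothesis (`AllXDesigns`, stated inline) is the construction item.  Evidence that it holds
(Cruxes/PeelingLemma/ALLX-MECHANISM.md): explicit designs on subdivided high-girth cubic graphs with
"wide FIFO" vertex vectors exist and are verified at every tested size (m = 288 … 19 800, all outputs
exactly binomial); their short relations are birthday coincidences whose number scales like m²/s⁴ and
vanishes along the family `q ≈ (log₂ m)²/4`, `L ≈ (log₂ m)²`, `s ≈ m/(3L)` (paper skeleton §5 there).
No declaration here is a definition and no conclusion asserts a Theses declaration positively.
-/

namespace Summit.ValiantsHypothesis.ValiantsHypothesis.Theorems.PeelingLemma.Negative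

-- summit = sub-problem name (single-conjunct summit, D-0017 layout), so the namespace repeats it
set_option linter.dupNamespace false

open Summit.ValiantsHypothesis.ValiantsHypothesis.Theses.BinomialElusive (PeelingLemma)
open scoped BigOperators

/-- **The all-X swallowing identity.**  For registers `p j = t^{α j}` (monomial, `mono j`) or
`t^{α j} + t^{β j}` (binomial) and an output `Γ = z_v z_w - z_a z_b - z_c z_d` with `v, w` binomial,
`a, b, c, d` monomial and the two planted coincidences, `Γ(p) = t^{α v + β w} + t^{β v + α w}`. -/
theorem aeval_allX {k : ℕ} (α β : Fin k → ℤ) (mono : Fin k → Bool) (v w a b c d : Fin k)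
    (hv : mono v = false) (hw : mono w = false) (ha : mono a = true) (hb : mono b = true)
    (hc : mono c = true) (hd : mono d = true)
    (hα : α v + α w = α a + α b) (hβ : β v + β w = α c + α d) :
    MvPolynomial.aeval (fun j => (HahnSeries.single (α j) (1 : ℂ) +
        (if mono j then 0 else HahnSeries.single (β j) (1 : ℂ)) : LaurentSeries ℂ))
      (MvPolynomial.X v * MvPolynomial.X w - MvPolynomial.X a * MvPolynomial.X b -
        MvPolynomial.X c * MvPolynomial.X d : MvPolynomial (Fin k) ℂ) =
      HahnSeries.single (α v + β w) (1 : ℂ) + HahnSeries.single (β v + α w) (1 : ℂ) := by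
  simp only [map_sub, map_mul, MvPolynomial.aeval_X, hv, hw, ha, hb, hc, hd, if_true, if_false,
    Bool.false_eq_true, add_zero]
  simp only [add_mul, mul_add, HahnSeries.single_mul_single, mul_one]
  rw [← hα, ← hβ]
  abel

/-- **`PeelingLemma` is false modulo all-X designs.**  If for every `m₀` there is an all-X design
(data `α β mono v w a b c d` with the planted coincidences, output exponents `e₁ i = α(v i) + β(w i)`,
`e₂ i = β(v i) + α(w i)` in `ℕ`) at some `m ≥ m₀` whose output exponents admit no nonzero integer
relation of length `≤ ⌊log₂ m⌋²`, then the crux `BinomialElusive.PeelingLemma` fails: the design's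
`Γ_i = z_{v i} z_{w i} - z_{a i} z_{b i} - z_{c i} z_{d i}` (total degree `2`) and Laurent registers
satisfy its hypotheses with `N = 1` (`aeval_allX`), so it would produce exactly such a relation. -/
theorem peelingLemma_false_of_allXDesigns
    (H : ∀ m₀ : ℕ, ∃ m ≥ m₀, ∃ (α β : Fin (m - 1) → ℤ) (mono : Fin (m - 1) → Bool)
      (v w a b c d : Fin m → Fin (m - 1)) (e₁ e₂ : Fin m → ℕ),
      (∀ i, mono (v i) = false ∧ mono (w i) = false ∧ mono (a i) = true ∧ mono (b i) = true ∧
        mono (c i) = true ∧ mono (d i) = true) ∧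
      (∀ i, α (v i) + α (w i) = α (a i) + α (b i)) ∧
      (∀ i, β (v i) + β (w i) = α (c i) + α (d i)) ∧
      (∀ i, (e₁ i : ℤ) = α (v i) + β (w i)) ∧ (∀ i, (e₂ i : ℤ) = β (v i) + α (w i)) ∧
      (∀ u u' : Fin m → ℤ, (u, u') ≠ 0 → ∑ i, (|u i| + |u' i|) ≤ ((Nat.log 2 m ^ 2 : ℕ) : ℤ) →
        ∑ i, (u i * (e₁ i : ℤ) + u' i * (e₂ i : ℤ)) ≠ 0)) :
    ¬ PeelingLemma := by
  rintro ⟨m₀, hP⟩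
  obtain ⟨m, hm, α, β, mono, v, w, a, b, c, d, e₁, e₂, hmono, hα, hβ, he₁, he₂, hnorel⟩ := H m₀
  -- the registers and the quadratic map of the design
  let p : Fin (m - 1) → LaurentSeries ℂ := fun j =>
    HahnSeries.single (α j) (1 : ℂ) + (if mono j then 0 else HahnSeries.single (β j) (1 : ℂ))
  let Γ : Fin m → MvPolynomial (Fin (m - 1)) ℂ := fun i =>
    MvPolynomial.X (v i) * MvPolynomial.X (w i) - MvPolynomial.X (a i) * MvPolynomial.X (b i) -
      MvPolynomial.X (c i) * MvPolynomial.X (d i)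
  have hXX : ∀ x y : Fin (m - 1),
      (MvPolynomial.X x * MvPolynomial.X y : MvPolynomial (Fin (m - 1)) ℂ).totalDegree ≤ 2 := by
    intro x y
    calc (MvPolynomial.X x * MvPolynomial.X y : MvPolynomial (Fin (m - 1)) ℂ).totalDegree
        ≤ (MvPolynomial.X x : MvPolynomial (Fin (m - 1)) ℂ).totalDegree +
            (MvPolynomial.X y : MvPolynomial (Fin (m - 1)) ℂ).totalDegree :=
          MvPolynomial.totalDegree_mul _ _
      _ = 2 := by rw [MvPolynomial.totalDegree_X, MvPolynomial.totalDegree_X]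
  have hdeg : ∀ i, (Γ i).totalDegree ≤ 2 := by
    intro i
    refine (MvPolynomial.totalDegree_sub _ _).trans (max_le ?_ (hXX _ _))
    exact (MvPolynomial.totalDegree_sub _ _).trans (max_le (hXX _ _) (hXX _ _))
  have hp : ∀ i, MvPolynomial.aeval p (Γ i) =
      HahnSeries.single ((1 * e₁ i : ℕ) : ℤ) (1 : ℂ) + HahnSeries.single ((1 * e₂ i : ℕ) : ℤ) (1 : ℂ) := by
    intro i
    obtain ⟨hv, hw, ha, hb, hc, hd⟩ := hmono i
    have h := aeval_allX α β mono (v i) (w i) (a i) (b i) (c i) (d i) hv hw ha hb hc hd (hα i) (hβ i)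
    rw [one_mul, one_mul, he₁ i, he₂ i]
    exact h
  obtain ⟨u, u', hne, hlen, hrel⟩ := hP m hm e₁ e₂ Γ 1 p hdeg one_pos hp
  exact hnorel u u' hne hlen hrel

end Summit.ValiantsHypothesis.ValiantsHypothesis.Theorems.PeelingLemma.Negative
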